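import Literature.AnabelianGeometry.EtaleTheta.SettingModelChiTwistedLatticeThetaCentre
import Literature.AnabelianGeometry.EtaleTheta.SettingModelChiKummerData
import HarnessLib

/-!
# The χ-twisted root model with an extra Tate lattice, file 2c: the twisted `y`-coordinate crossed homomorphism
# `ŷ□(g) := ŷ(γ)·t₁` on `Π^tp_X□` and on `(Π^tp_X□)^Θ` (the `log(U)`-cocycle input of the Kummer core of `modelLat`)

Mochizuki, *The étale theta function …*, Publ. RIMS **45** (2009) [EtTh], §1, Prop. 1.5, PRIMS PDF p. 23 ("`log(U)`",
"`log(U)|_Ÿ = 2·log(Ü)`") [cite: MochizukiEtTh2009, Prop 1.5 p.23].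

LATTICE TWIST OF `Ẑ(1)²` — NOT the (B) section twist (cf. file 1, `SettingModelChiTwistedLattice.lean`, and abc-iut-L2-lead
R709).  abc-iut cell, K-L6 slice, row «KL6-CLOSURE-CERT F-2633», seat abc-iut-L6-t19 (gen 8).  Mirror of abc-iut-w5-d171's
`yCoordχ` / `yThetaχ` (`SettingModelChiKummerData`) for the lattice model, BY NAME over files 1–2b:

* **`yCoordLat g := ê_b(pr₁ γ) · t₁`** for `g = ((γ, (t₁, t₂)); σ)` — the `y`-coordinate of `γ` TIMES the first lattice coordinate
  (so that `Π□_Ÿ = {y₂ + ℓ₂(t₁) = 0}` is exactly where `ŷ□` is a square); the χ-crossed homomorphism law `yCoordLat_mul`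
  (both factors scale by `χ(σ)`: `eHatB_twist` and the diagonal action `actLatt`); continuity; `yCoordLat (ι g₀) = yCoordχ g₀`;
  `ŷ□` kills the theta kernel (`left_snd_eq_one_of_mem_thetaKer` + `iotaPi_mem_thetaKer_iff` + `yCoordχ_eq_one_of_mem_thetaKer`);
* **`yThetaLat`** — `ŷ□` descended to `(Π^tp_X□)^Θ`, `yThetaLat_toTheta`, continuity, and the law
  `yThetaLat (x y) = yThetaLat x · χ(aug^Θ x)(yThetaLat y)`.
File 2 proper then sets `logU□ := [g ↦ deltaThetaCoordLat (yThetaLat g)]`, `logUdd□ :=` its half on `(Π□_Ÿ)^Θ`, exactly as in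
`SettingModelChiKummerData` (steps 4–5 of HOME/staging/L6/L6-t19/gen8/HANDOFF-F2633-SWAP-TOWER.md).

HONEST LABEL: semi-synthetic model bookkeeping; nothing of [EtTh] asserted; no side taken on [IUTchIII] Cor. 3.12.  Class (b)
construction file (def-bearing: `yCoordLat`, `yThetaLat`; no instance, no notation, no Prop-valued def).
-/

noncomputable section

namespace Literature.AnabelianGeometry.EtaleTheta.SettingModel

open Literature.AnabelianGeometry.SemiGraphs _root_.Topology _root_.Function

variable (p : ℕ) [Fact p.Prime]

/-- Middle-four exchange in the commutative group `Ẑ`. [cite: RibesZalesskii2010, Thm 2.7.1] -/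
private theorem zh_mul_mul_mul_comm (a b c d : ZH) : a * b * (c * d) = a * c * (b * d) := by
  rw [mul_assoc, mul_assoc, ← mul_assoc b, Literature.AnabelianGeometry.AbsoluteAnabelian.ZHatCompletion.mul_comm b c,
    mul_assoc]

/-! ### `ŷ□` on `Π^tp_X□` -/

/-- **`ŷ□(g) := ê_b(pr₁ γ) · t₁ ∈ Ẑ`** for `g = ((γ, (t₁, t₂)); σ) ∈ Π^tp_X□`. [cite: MochizukiEtTh2009, Prop 1.5 p.23] -/
def yCoordLat (g : PiTpLat p) : ZH := eHatB (gfpFst g.left.1) * g.left.2.1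

/-- [cite: MochizukiEtTh2009, Prop 1.5 p.23] -/
theorem yCoordLat_apply (g : PiTpLat p) : yCoordLat p g = eHatB (gfpFst g.left.1) * g.left.2.1 := rfl

/-- **`ŷ□(gh) = ŷ□(g) · χ(g)(ŷ□(h))`** — the χ-crossed homomorphism law (the `y`-coordinate and the first lattice coordinate BOTH
scale by `χ(σ)`). [cite: MochizukiEtTh2009, Prop 1.5 p.23] -/
theorem yCoordLat_mul (g h : PiTpLat p) : yCoordLat p (g * h) = yCoordLat p g * chi p g.right (yCoordLat p h) := by
  rw [yCoordLat_apply, yCoordLat_apply, yCoordLat_apply, SemidirectProduct.mul_left, actLat_apply]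
  change eHatB (gfpFst (g.left.1 * actχ p g.right h.left.1)) * (g.left.2.1 * (actLatt p g.right h.left.2).1) = _
  rw [map_mul, map_mul, gfpFst_actχ, actHatχ_apply, eHatB_twist, actLatt_apply, map_mul]
  exact zh_mul_mul_mul_comm _ _ _ _

/-- `ŷ□` is continuous. [cite: MochizukiEtTh2009, Prop 1.5 p.23] -/
theorem continuous_yCoordLat : Continuous (yCoordLat p) := by
  have hl : Continuous fun g : PiTpLat p => g.left := Semidirect.continuous_left (isInducing_leftRightLat p)
  exact (eHatB.continuous.comp (gfpFst.continuous.comp (continuous_fst.comp hl))).mul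
    (continuous_fst.comp (continuous_snd.comp hl))

/-- `ŷ□ ∘ ι = ŷ` (the slice `t = 1`). [cite: MochizukiEtTh2009, Prop 1.5 p.23] -/
theorem yCoordLat_iotaPi (g₀ : PiTpχ p) : yCoordLat p (iotaPi p g₀) = yCoordχ p g₀ := by
  rw [yCoordLat_apply, iotaPi_left]
  change eHatB (gfpFst g₀.left) * 1 = yCoordχ p g₀
  rw [mul_one]
  rfl

/-- An element of the theta kernel of `curveLat` is the `ι`-image of an element of the theta kernel of `curveχ`.
[cite: MochizukiEtTh2009, §1 p.12] -/
theorem exists_iotaPi_eq_of_mem_thetaKer {g : PiTpLat p} (hg : g ∈ CurveTheta.thetaKer (curveLat p)) :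
    ∃ g₀ ∈ CurveTheta.thetaKer (curveχ p), iotaPi p g₀ = g := by
  have ht : g.left.2 = 1 := left_snd_eq_one_of_mem_thetaKer p hg
  have hg' : iotaPi p ⟨g.left.1, g.right⟩ = g := by
    have e := eq_inl_latt_mul_iotaPi p g
    rw [ht] at e
    have h1 : (SemidirectProduct.inl ((1 : Gfp), (1 : Latt)) : PiTpLat p) = 1 := by
      rw [show ((1 : Gfp), (1 : Latt)) = (1 : GfpLat) from rfl, map_one]
    rw [h1, one_mul] at e
    exact e.symm
  refine ⟨⟨g.left.1, g.right⟩, ?_, hg'⟩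
  rw [← iotaPi_mem_thetaKer_iff, hg']
  exact hg

/-- `ŷ□` kills `Ker(Π^tp_X□ ↠ (Π^tp_X□)^Θ)`. [cite: MochizukiEtTh2009, Prop 1.5 p.23] -/
theorem yCoordLat_eq_one_of_mem_thetaKer {g : PiTpLat p} (hg : g ∈ CurveTheta.thetaKer (curveLat p)) :
    yCoordLat p g = 1 := by
  obtain ⟨g₀, hg₀, rfl⟩ := exists_iotaPi_eq_of_mem_thetaKer p hg
  rw [yCoordLat_iotaPi]
  exact yCoordχ_eq_one_of_mem_thetaKer p hg₀

/-! ### `ŷ□` on `(Π^tp_X□)^Θ` -/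

/-- `ŷ□` descended to `(Π^tp_X□)^Θ`. [cite: MochizukiEtTh2009, Prop 1.5 p.23] -/
def yThetaLat : CurveTheta.GTheta (curveLat p) → ZH :=
  Quotient.lift (yCoordLat p) fun a b hab => by
    have hab' : a⁻¹ * b ∈ CurveTheta.thetaKer (curveLat p) := QuotientGroup.leftRel_apply.mp hab
    have hb : b = a * (a⁻¹ * b) := by group
    have := yCoordLat_mul p a (a⁻¹ * b)
    rw [← hb, yCoordLat_eq_one_of_mem_thetaKer p hab', map_one, mul_one] at this
    exact this.symm

/-- [cite: MochizukiEtTh2009, Prop 1.5 p.23] -/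
@[simp] theorem yThetaLat_toTheta (g : PiTpLat p) : yThetaLat p (CurveTheta.toTheta (curveLat p) g) = yCoordLat p g := rfl

/-- `ŷ□` on `(Π^tp_X□)^Θ` is continuous (quotient topology). [cite: MochizukiEtTh2009, Prop 1.5 p.23] -/
theorem continuous_yThetaLat : Continuous (yThetaLat p) :=
  (QuotientGroup.isQuotientMap_mk (CurveTheta.thetaKer (curveLat p))).continuous_iff.mpr (continuous_yCoordLat p)

/-- **The crossed-homomorphism law on `(Π^tp_X□)^Θ`**: `ŷ□(xy) = ŷ□(x) · χ(aug^Θ x)(ŷ□(y))`. [cite: MochizukiEtTh2009, Prop 1.5 p.23] -/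
theorem yThetaLat_mul (x y : CurveTheta.GTheta (curveLat p)) :
    yThetaLat p (x * y) = yThetaLat p x * chi p (CurveTheta.augTheta (curveLat p) x) (yThetaLat p y) := by
  obtain ⟨g, rfl⟩ := CurveTheta.toTheta_surjective (curveLat p) x
  obtain ⟨h, rfl⟩ := CurveTheta.toTheta_surjective (curveLat p) y
  rw [← map_mul, yThetaLat_toTheta, yThetaLat_toTheta, yThetaLat_toTheta, CurveTheta.augTheta_toTheta, yCoordLat_mul]
  rfl

/-- `ŷ□ ∘ iotaTheta = ŷ` on `(Π^tp_Xχ)^Θ`. [cite: MochizukiEtTh2009, Prop 1.5 p.23] -/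
theorem yThetaLat_iotaTheta (x₀ : CurveTheta.GTheta (curveχ p)) : yThetaLat p (iotaTheta p x₀) = yThetaχ p x₀ := by
  obtain ⟨g₀, rfl⟩ := CurveTheta.toTheta_surjective (curveχ p) x₀
  rw [iotaTheta_toTheta, yThetaLat_toTheta, yThetaχ_toTheta, yCoordLat_iotaPi]

end Literature.AnabelianGeometry.EtaleTheta.SettingModel

end
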